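import Summits.KontsevichZagierPeriods.KontsevichZagierPeriods.Theorems.SymplecticScissorsRealOnePeriodRelationsStubHomotopyInvarianceAux3

/-!
# `RealOnePeriodRelations` (stmt-KontsevichZagierPeriods-10042), line `nash-retraction-thin-strip`,
# stub `stub_homotopyInvariance` — auxiliary file 4: vertices and edges of the grid

Helper for the stub `stub_homotopyInvariance` (homotopy coherence in the move world), continued
(registered anchor: `helper_homotopyInvariance_4` = `exists_grid_edges`): given semialgebraic `C¹`
replacement of continuous paths inside open sets (`stub_saPathSubset`), a continuous
`H : ℝ² → Z(ℂ)`, `N ≥ 1` and open regions `Rx p q ⊇ H(cell (p,q))` whose boundary vertices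
`H(p/N, q/N)` are algebraic points, the vertices of the grid are replaced by ALGEBRAIC points
(the old ones on the boundary; in the interior nearby algebraic points of `Z`,
`CurveData.IsSmoothAffineCurve.exists_algebraicPoint_mem`, inside a vertex chart contained in the
four adjacent regions, joined to the old vertex by a chart link, `CurvePeriods.exists_vertexLink`)
and the edges by `ℚ`-SEMIALGEBRAIC `C¹` paths between the new vertices inside the intersection of
the two adjacent regions (Steps 2–5 of the tree's
`CurvePeriods.span_single_sub_single_of_continuousHomotopy`, with `exists_curvePath_subset`
replaced by the semialgebraic replacement).

References: A. Huber, G. Wüstholz, *Transcendence and Linear Relations of 1-Periods* (2022), §3.3.1.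
-/

noncomputable section

open scoped BigOperators Topology unitInterval
open Set MeasureTheory Filter
open Literature.NumberTheory.Transcendental Literature.NumberTheory.Transcendental.CurvePeriods
open Literature.ModelTheory.ExponentialFields (IsSemialgebraic)
open Summit.KontsevichZagierPeriods.SymplecticScissors.RealOnePeriodRelationsNegative (M₁ unitDom)
open Summit.KontsevichZagierPeriods.Theorems.StuffleInKZ.Negative.LogShadow (isSemialgebraic_Icc01)

namespace Summit.KontsevichZagierPeriods.SymplecticScissors.RealOnePeriodRelations.HomotopyInvariance

/-- **Vertices and edges of the grid.** Given semialgebraic `C¹` replacement of continuous paths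
(`stub_saPathSubset`, for the curve `Z`), a continuous `H : ℝ² → Z(ℂ)`, `N ≥ 1` and open regions
`Rx p q ⊇ H(cell (p, q))`, such that the boundary vertices `H(p/N, q/N)` (`p ∈ {0, N}` or
`q ∈ {0, N}`) are algebraic points: there are new vertices `A p q` — the old ones on the boundary,
nearby ALGEBRAIC points of `Z` in the interior (`exists_algebraicPoint_mem`, inside a vertex chart
contained in the four adjacent regions) — and `ℚ`-semialgebraic `C¹` edges between them, the
horizontal edge `(p,q) → (p+1,q)` inside `Rx p (q−1) ∩ Rx p q` and the vertical edge
`(p,q) → (p,q+1)` inside `Rx (p−1) q ∩ Rx p q` (continuous edge `link⁻¹ · H-edge · link`, then the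
replacement). [cite: HuberWustholz2022, §3.3.1] -/
theorem exists_grid_edges {Z : CurveData} (hZ : Z.IsSmoothAffineCurve)
    (hPath : ∀ (G : Set (Fin Z.n → ℂ)), IsOpen G → ∀ (e : ℝ → (Fin Z.n → ℂ)),
      ContinuousOn e (Set.Icc 0 1) → (∀ t ∈ Set.Icc (0 : ℝ) 1, e t ∈ Z.points) →
      (∀ t ∈ Set.Icc (0 : ℝ) 1, e t ∈ G) → (∀ i, IsAlgebraic ℚ (e 0 i)) → (∀ i, IsAlgebraic ℚ (e 1 i)) →
      ∃ γ : CurvePath Z, IsSemialgebraicMapOn ℚ {z : Fin 1 → ℝ | z 0 ∈ Set.Icc (0 : ℝ) 1}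
          (fun z => Fin.append (fun i => (γ.toFun (z 0) i).re) (fun i => (γ.toFun (z 0) i).im)) ∧
        γ.toFun 0 = e 0 ∧ γ.toFun 1 = e 1 ∧ ∀ t ∈ Set.Icc (0 : ℝ) 1, γ.toFun t ∈ G)
    {H : ℝ × ℝ → (Fin Z.n → ℂ)} (hHc : Continuous H) (hHZ' : ∀ x, H x ∈ Z.points)
    {N : ℕ} (hN : 0 < N) (Rx : ℕ → ℕ → Set (Fin Z.n → ℂ)) (hRxo : ∀ p q, IsOpen (Rx p q))
    (hRxc : ∀ p q x, x ∈ gridCell N p q → x ∈ Icc (0 : ℝ) 1 ×ˢ Icc (0 : ℝ) 1 → H x ∈ Rx p q)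
    (hvalg : ∀ p q, p ≤ N → q ≤ N → (p = 0 ∨ N ≤ p ∨ q = 0 ∨ N ≤ q) →
      ∀ i, IsAlgebraic ℚ (H ((p : ℝ) / N, (q : ℝ) / N) i)) :
    ∃ (A : ℕ → ℕ → (Fin Z.n → ℂ)) (eH eV : ℕ → ℕ → CurvePath Z),
      (∀ p q, (p = 0 ∨ N ≤ p ∨ q = 0 ∨ N ≤ q) → A p q = H ((p : ℝ) / N, (q : ℝ) / N)) ∧
      (∀ p q, p < N ∧ 0 < q ∧ q < N →
        IsSemialgebraicMapOn ℚ {z : Fin 1 → ℝ | z 0 ∈ Set.Icc (0 : ℝ) 1}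
          (fun z => Fin.append (fun i => ((eH p q).toFun (z 0) i).re)
            (fun i => ((eH p q).toFun (z 0) i).im)) ∧
        (eH p q).toFun 0 = A p q ∧ (eH p q).toFun 1 = A (p + 1) q ∧
        ∀ t ∈ Icc (0 : ℝ) 1, (eH p q).toFun t ∈ Rx p (q - 1) ∩ Rx p q) ∧
      (∀ p q, 0 < p ∧ p < N ∧ q < N →
        IsSemialgebraicMapOn ℚ {z : Fin 1 → ℝ | z 0 ∈ Set.Icc (0 : ℝ) 1}
          (fun z => Fin.append (fun i => ((eV p q).toFun (z 0) i).re)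
            (fun i => ((eV p q).toFun (z 0) i).im)) ∧
        (eV p q).toFun 0 = A p q ∧ (eV p q).toFun 1 = A p (q + 1) ∧
        ∀ t ∈ Icc (0 : ℝ) 1, (eV p q).toFun t ∈ Rx (p - 1) q ∩ Rx p q) := by
  classical
  have hN' : (0 : ℝ) < N := by exact_mod_cast hN
  have hH : ContinuousOn H (Icc (0 : ℝ) 1 ×ˢ Icc (0 : ℝ) 1) := hHc.continuousOn
  have hI0 : (0 : ℝ) ∈ Icc (0 : ℝ) 1 := ⟨le_rfl, zero_le_one⟩
  have hI1 : (1 : ℝ) ∈ Icc (0 : ℝ) 1 := ⟨zero_le_one, le_rfl⟩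
  haveI : Nonempty (Fin Z.n) := ⟨⟨0, Nat.pos_of_ne_zero (n_ne_zero_of_mem hZ (hHZ' (0, 0)))⟩⟩
  ------------------------------------------------------------------
  -- Step 2: vertices `v p q = H(p/N, q/N)`, neighbourhoods `G p q`, vertex charts
  ------------------------------------------------------------------
  let v : ℕ → ℕ → (Fin Z.n → ℂ) := fun p q => H ((p : ℝ) / N, (q : ℝ) / N)
  let G : ℕ → ℕ → Set (Fin Z.n → ℂ) := fun p q =>
    Rx (p - 1) (q - 1) ∩ Rx (p - 1) q ∩ Rx p (q - 1) ∩ Rx p q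
  have hGo : ∀ p q, IsOpen (G p q) := fun p q =>
    (((hRxo _ _).inter (hRxo _ _)).inter (hRxo _ _)).inter (hRxo _ _)
  have hG1 : ∀ p q, G p q ⊆ Rx (p - 1) (q - 1) := fun p q =>
    (inter_subset_left.trans inter_subset_left).trans inter_subset_left
  have hG2 : ∀ p q, G p q ⊆ Rx (p - 1) q := fun p q =>
    (inter_subset_left.trans inter_subset_left).trans inter_subset_right
  have hG3 : ∀ p q, G p q ⊆ Rx p (q - 1) := fun p q => inter_subset_left.trans inter_subset_right
  have hG4 : ∀ p q, G p q ⊆ Rx p q := fun p q => inter_subset_right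
  have hvK : ∀ p q, p ≤ N → q ≤ N → ((p : ℝ) / N, (q : ℝ) / N) ∈ Icc (0 : ℝ) 1 ×ˢ Icc (0 : ℝ) 1 :=
    fun p q hp hq => ⟨div_mem_Icc hN hp, div_mem_Icc hN hq⟩
  have hvZ : ∀ p q, v p q ∈ Z.points := fun p q => hHZ' _
  have hcorner : ∀ p q p' q', (p' = p - 1 ∨ p' = p) → (q' = q - 1 ∨ q' = q) →
      ((p : ℝ) / N, (q : ℝ) / N) ∈ gridCell N p' q' := fun p q p' q' hp' hq' =>
    mem_gridCell_of hN (cast_le_and_le_of_pred_or_eq hp').1 (cast_le_and_le_of_pred_or_eq hp').2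
      (cast_le_and_le_of_pred_or_eq hq').1 (cast_le_and_le_of_pred_or_eq hq').2
  have hvG : ∀ p q, p ≤ N → q ≤ N → v p q ∈ G p q := fun p q hp hq =>
    ⟨⟨⟨hRxc _ _ _ (hcorner p q _ _ (Or.inl rfl) (Or.inl rfl)) (hvK p q hp hq),
       hRxc _ _ _ (hcorner p q _ _ (Or.inl rfl) (Or.inr rfl)) (hvK p q hp hq)⟩,
      hRxc _ _ _ (hcorner p q _ _ (Or.inr rfl) (Or.inl rfl)) (hvK p q hp hq)⟩,
     hRxc _ _ _ (hcorner p q _ _ (Or.inr rfl) (Or.inr rfl)) (hvK p q hp hq)⟩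
  have hvch : ∀ p q, p ≤ N ∧ q ≤ N → ∃ (i₀ : Fin Z.n) (ε : ℝ) (Ω : Set (Fin Z.n → ℂ))
      (ψ : ℂ → (Fin Z.n → ℂ)), 0 < ε ∧ IsOpen Ω ∧ v p q ∈ Ω ∧ Ω ⊆ G p q ∧
      AnalyticOnNhd ℂ ψ (Metric.ball (v p q i₀) ε) ∧
      (∀ z ∈ Ω, z ∈ Z.points → z i₀ ∈ Metric.ball (v p q i₀) ε ∧ ψ (z i₀) = z) ∧
      (∀ w ∈ Metric.ball (v p q i₀) ε, ψ w ∈ Ω ∧ ψ w ∈ Z.points ∧ ψ w i₀ = w) :=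
    fun p q hpq => exists_localChart_subset hZ (hvZ p q) (hGo p q) (hvG p q hpq.1 hpq.2)
  choose! ιv εv Ωv ψv hεv hΩvo hvΩv hΩvG hψv h1v h2v using hvch
  ------------------------------------------------------------------
  -- Step 3: the new vertices `A p q` (algebraic): `v p q` on the boundary, nearby algebraic
  -- points in the interior
  ------------------------------------------------------------------
  have hapt : ∀ p q, p ≤ N ∧ q ≤ N → ∃ a : Fin Z.n → ℂ,
      a ∈ Ωv p q ∩ (fun z : Fin Z.n → ℂ => z (ιv p q)) ⁻¹' Metric.ball (v p q (ιv p q)) (εv p q / 2) ∧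
      a ∈ Z.points ∧ ∀ i, IsAlgebraic ℚ (a i) := by
    intro p q hpq
    have hO : IsOpen (Ωv p q ∩
        (fun z : Fin Z.n → ℂ => z (ιv p q)) ⁻¹' Metric.ball (v p q (ιv p q)) (εv p q / 2)) :=
      (hΩvo p q hpq).inter (Metric.isOpen_ball.preimage (continuous_apply (ιv p q)))
    obtain ⟨a, haO, haZ, haa⟩ := hZ.exists_algebraicPoint_mem (hvZ p q) hO
      ⟨hvΩv p q hpq, Metric.mem_ball_self (half_pos (hεv p q hpq))⟩
    exact ⟨a, haO, haZ, haa⟩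
  choose! apt haptO haptZ hapta using hapt
  let A : ℕ → ℕ → (Fin Z.n → ℂ) := fun p q =>
    if p = 0 ∨ N ≤ p ∨ q = 0 ∨ N ≤ q then v p q else apt p q
  have hA_bd : ∀ p q, (p = 0 ∨ N ≤ p ∨ q = 0 ∨ N ≤ q) → A p q = v p q := fun p q h => if_pos h
  have hA_int : ∀ p q, ¬ (p = 0 ∨ N ≤ p ∨ q = 0 ∨ N ≤ q) → A p q = apt p q := fun p q h => if_neg h
  have hAZ : ∀ p q, p ≤ N → q ≤ N → A p q ∈ Z.points := by
    intro p q hp hq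
    by_cases hbd : p = 0 ∨ N ≤ p ∨ q = 0 ∨ N ≤ q
    · rw [hA_bd p q hbd]; exact hvZ p q
    · rw [hA_int p q hbd]; exact haptZ p q ⟨hp, hq⟩
  have hAa : ∀ p q, p ≤ N → q ≤ N → ∀ i, IsAlgebraic ℚ (A p q i) := by
    intro p q hp hq
    by_cases hbd : p = 0 ∨ N ≤ p ∨ q = 0 ∨ N ≤ q
    · rw [hA_bd p q hbd]; exact hvalg p q hp hq hbd
    · rw [hA_int p q hbd]; exact hapta p q ⟨hp, hq⟩
  haveI : Nonempty (CurvePath Z) :=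
    ⟨CurvePath.const (A 0 0) (hAZ 0 0 (Nat.zero_le N) (Nat.zero_le N))
      (hAa 0 0 (Nat.zero_le N) (Nat.zero_le N))⟩
  have hAΩv : ∀ p q, p ≤ N → q ≤ N → A p q ∈ Ωv p q := by
    intro p q hp hq
    by_cases hbd : p = 0 ∨ N ≤ p ∨ q = 0 ∨ N ≤ q
    · rw [hA_bd p q hbd]; exact hvΩv p q ⟨hp, hq⟩
    · rw [hA_int p q hbd]; exact (haptO p q ⟨hp, hq⟩).1
  have hAball : ∀ p q, p ≤ N → q ≤ N →
      A p q (ιv p q) ∈ Metric.ball (v p q (ιv p q)) (εv p q / 2) := by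
    intro p q hp hq
    by_cases hbd : p = 0 ∨ N ≤ p ∨ q = 0 ∨ N ≤ q
    · rw [hA_bd p q hbd]; exact Metric.mem_ball_self (half_pos (hεv p q ⟨hp, hq⟩))
    · rw [hA_int p q hbd]; exact (haptO p q ⟨hp, hq⟩).2
  have hψA : ∀ p q, p ≤ N → q ≤ N → ψv p q (A p q (ιv p q)) = A p q := fun p q hp hq =>
    (h1v p q ⟨hp, hq⟩ _ (hAΩv p q hp hq) (hAZ p q hp hq)).2
  have hψvv : ∀ p q, p ≤ N → q ≤ N → ψv p q (v p q (ιv p q)) = v p q := fun p q hp hq =>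
    (h1v p q ⟨hp, hq⟩ _ (hvΩv p q ⟨hp, hq⟩) (hvZ p q)).2
  ------------------------------------------------------------------
  -- Step 4: links `A p q → v p q` and the semialgebraic `C¹` edges
  ------------------------------------------------------------------
  have hlink : ∀ p q, p ≤ N ∧ q ≤ N → ∃ κ : ℝ → (Fin Z.n → ℂ), Continuous κ ∧ κ 0 = A p q ∧
      κ 1 = v p q ∧ (∀ t, κ t ∈ Z.points) ∧ ∀ t, κ t ∈ Ωv p q := fun p q hpq =>
    exists_vertexLink (hψv p q hpq) (h2v p q hpq)
      ((h1v p q hpq _ (hAΩv p q hpq.1 hpq.2) (hAZ p q hpq.1 hpq.2)).1)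
      ((h1v p q hpq _ (hvΩv p q hpq) (hvZ p q)).1) (hψA p q hpq.1 hpq.2) (hψvv p q hpq.1 hpq.2)
  choose! κ hκc hκ0 hκ1 hκZ hκΩ using hlink
  -- horizontal edges `(p, q) → (p+1, q)`, `p < N`, `0 < q < N`, inside `Rx p (q-1) ∩ Rx p q`
  have hedge_h : ∀ p q, p < N ∧ 0 < q ∧ q < N → ∃ g : CurvePath Z,
      IsSemialgebraicMapOn ℚ {z : Fin 1 → ℝ | z 0 ∈ Set.Icc (0 : ℝ) 1}
        (fun z => Fin.append (fun i => (g.toFun (z 0) i).re) (fun i => (g.toFun (z 0) i).im)) ∧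
      g.toFun 0 = A p q ∧ g.toFun 1 = A (p + 1) q ∧
      ∀ t ∈ Icc (0 : ℝ) 1, g.toFun t ∈ Rx p (q - 1) ∩ Rx p q := by
    rintro p q ⟨hp, hq0, hqN⟩
    have hpq : p ≤ N ∧ q ≤ N := ⟨hp.le, hqN.le⟩
    have hpq' : p + 1 ≤ N ∧ q ≤ N := ⟨hp, hqN.le⟩
    have heK : ∀ t : ℝ, (((p : ℝ) + clamp01 t) / N, (q : ℝ) / N) ∈ gridCell N p (q - 1) ∩ gridCell N p q :=
      fun t => ⟨mem_gridCell_of hN (by linarith [(clamp01_mem t).1]) (by linarith [(clamp01_mem t).2])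
          (cast_le_and_le_of_pred_or_eq (Or.inl rfl)).1 (cast_le_and_le_of_pred_or_eq (Or.inl rfl)).2,
        mem_gridCell_of hN (by linarith [(clamp01_mem t).1]) (by linarith [(clamp01_mem t).2])
          le_rfl (by linarith)⟩
    have heSq : ∀ t : ℝ, (((p : ℝ) + clamp01 t) / N, (q : ℝ) / N) ∈ Icc (0 : ℝ) 1 ×ˢ Icc (0 : ℝ) 1 :=
      fun t => gridCell_subset_square hN hp hqN (heK t).2
    have hec : Continuous fun t : ℝ => H (((p : ℝ) + clamp01 t) / N, (q : ℝ) / N) :=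
      hH.comp_continuous (((continuous_const.add continuous_clamp01).div_const _).prodMk
        continuous_const) heSq
    obtain ⟨c, hcc, hc0, hc1, hcZ, hcG⟩ := exists_edgeCont (G := Rx p (q - 1) ∩ Rx p q) (κ p q)
      (hκc p q hpq) (hκ0 p q hpq) (hκ1 p q hpq) (hκZ p q hpq)
      (fun t => ⟨hG3 p q (hΩvG p q hpq (hκΩ p q hpq t)), hG4 p q (hΩvG p q hpq (hκΩ p q hpq t))⟩)
      (fun t : ℝ => H (((p : ℝ) + clamp01 t) / N, (q : ℝ) / N)) hec
      (by show H (((p : ℝ) + clamp01 0) / N, (q : ℝ) / N) = H ((p : ℝ) / N, (q : ℝ) / N)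
          rw [clamp01_of_mem hI0, add_zero])
      (by show H (((p : ℝ) + clamp01 1) / N, (q : ℝ) / N) = H ((((p + 1 : ℕ)) : ℝ) / N, (q : ℝ) / N)
          rw [clamp01_of_mem hI1]; push_cast; rfl)
      (fun t _ => hHZ' _) (fun t _ => ⟨hRxc _ _ _ (heK t).1 (heSq t), hRxc _ _ _ (heK t).2 (heSq t)⟩)
      (κ (p + 1) q) (hκc _ _ hpq') (hκ0 _ _ hpq') (hκ1 _ _ hpq') (hκZ _ _ hpq') (fun t => by
        have h1 := hG1 (p + 1) q (hΩvG (p + 1) q hpq' (hκΩ _ _ hpq' t))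
        have h2 := hG2 (p + 1) q (hΩvG (p + 1) q hpq' (hκΩ _ _ hpq' t))
        rw [Nat.add_sub_cancel] at h1 h2
        exact ⟨h1, h2⟩)
    obtain ⟨g, hgsa, hg0, hg1, hgG⟩ := hPath (Rx p (q - 1) ∩ Rx p q) ((hRxo _ _).inter (hRxo _ _))
      c hcc.continuousOn hcZ hcG (by rw [hc0]; exact hAa p q hpq.1 hpq.2)
      (by rw [hc1]; exact hAa (p + 1) q hpq'.1 hpq'.2)
    exact ⟨g, hgsa, hg0.trans hc0, hg1.trans hc1, hgG⟩
  choose! eH hEH using hedge_h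
  -- vertical edges `(p, q) → (p, q+1)`, `0 < p < N`, `q < N`, inside `Rx (p-1) q ∩ Rx p q`
  have hedge_v : ∀ p q, 0 < p ∧ p < N ∧ q < N → ∃ g : CurvePath Z,
      IsSemialgebraicMapOn ℚ {z : Fin 1 → ℝ | z 0 ∈ Set.Icc (0 : ℝ) 1}
        (fun z => Fin.append (fun i => (g.toFun (z 0) i).re) (fun i => (g.toFun (z 0) i).im)) ∧
      g.toFun 0 = A p q ∧ g.toFun 1 = A p (q + 1) ∧
      ∀ t ∈ Icc (0 : ℝ) 1, g.toFun t ∈ Rx (p - 1) q ∩ Rx p q := by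
    rintro p q ⟨hp0, hpN, hq⟩
    have hpq : p ≤ N ∧ q ≤ N := ⟨hpN.le, hq.le⟩
    have hpq' : p ≤ N ∧ q + 1 ≤ N := ⟨hpN.le, hq⟩
    have heK : ∀ t : ℝ, ((p : ℝ) / N, ((q : ℝ) + clamp01 t) / N) ∈ gridCell N (p - 1) q ∩ gridCell N p q :=
      fun t => ⟨mem_gridCell_of hN (cast_le_and_le_of_pred_or_eq (Or.inl rfl)).1
          (cast_le_and_le_of_pred_or_eq (Or.inl rfl)).2
          (by linarith [(clamp01_mem t).1]) (by linarith [(clamp01_mem t).2]),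
        mem_gridCell_of hN le_rfl (by linarith) (by linarith [(clamp01_mem t).1])
          (by linarith [(clamp01_mem t).2])⟩
    have heSq : ∀ t : ℝ, ((p : ℝ) / N, ((q : ℝ) + clamp01 t) / N) ∈ Icc (0 : ℝ) 1 ×ˢ Icc (0 : ℝ) 1 :=
      fun t => gridCell_subset_square hN hpN hq (heK t).2
    have hec : Continuous fun t : ℝ => H ((p : ℝ) / N, ((q : ℝ) + clamp01 t) / N) :=
      hH.comp_continuous (continuous_const.prodMk
        ((continuous_const.add continuous_clamp01).div_const _)) heSq
    obtain ⟨c, hcc, hc0, hc1, hcZ, hcG⟩ := exists_edgeCont (G := Rx (p - 1) q ∩ Rx p q) (κ p q)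
      (hκc p q hpq) (hκ0 p q hpq) (hκ1 p q hpq) (hκZ p q hpq)
      (fun t => ⟨hG2 p q (hΩvG p q hpq (hκΩ p q hpq t)), hG4 p q (hΩvG p q hpq (hκΩ p q hpq t))⟩)
      (fun t : ℝ => H ((p : ℝ) / N, ((q : ℝ) + clamp01 t) / N)) hec
      (by show H ((p : ℝ) / N, ((q : ℝ) + clamp01 0) / N) = H ((p : ℝ) / N, (q : ℝ) / N)
          rw [clamp01_of_mem hI0, add_zero])
      (by show H ((p : ℝ) / N, ((q : ℝ) + clamp01 1) / N) = H ((p : ℝ) / N, (((q + 1 : ℕ)) : ℝ) / N)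
          rw [clamp01_of_mem hI1]; push_cast; rfl)
      (fun t _ => hHZ' _) (fun t _ => ⟨hRxc _ _ _ (heK t).1 (heSq t), hRxc _ _ _ (heK t).2 (heSq t)⟩)
      (κ p (q + 1)) (hκc _ _ hpq') (hκ0 _ _ hpq') (hκ1 _ _ hpq') (hκZ _ _ hpq') (fun t => by
        have h1 := hG1 p (q + 1) (hΩvG p (q + 1) hpq' (hκΩ _ _ hpq' t))
        have h3 := hG3 p (q + 1) (hΩvG p (q + 1) hpq' (hκΩ _ _ hpq' t))
        rw [Nat.add_sub_cancel] at h1 h3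
        exact ⟨h1, h3⟩)
    obtain ⟨g, hgsa, hg0, hg1, hgG⟩ := hPath (Rx (p - 1) q ∩ Rx p q) ((hRxo _ _).inter (hRxo _ _))
      c hcc.continuousOn hcZ hcG (by rw [hc0]; exact hAa p q hpq.1 hpq.2)
      (by rw [hc1]; exact hAa p (q + 1) hpq'.1 hpq'.2)
    exact ⟨g, hgsa, hg0.trans hc0, hg1.trans hc1, hgG⟩
  choose! eV hEV using hedge_v
  exact ⟨A, eH, eV, hA_bd, hEH, hEV⟩

end Summit.KontsevichZagierPeriods.SymplecticScissors.RealOnePeriodRelations.HomotopyInvariance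

namespace Summit.KontsevichZagierPeriods.SymplecticScissors.RealOnePeriodRelations

/-- **Registered anchor `helper_homotopyInvariance_4` (VERTICES AND EDGES OF THE GRID).** See
`HomotopyInvariance.exists_grid_edges`. [cite: HuberWustholz2022, §3.3.1] -/
theorem helper_homotopyInvariance_4 : ∀ (Z : CurveData), Z.IsSmoothAffineCurve → (∀ (G : Set (Fin Z.n → ℂ)), IsOpen G → ∀ (e : ℝ → (Fin Z.n → ℂ)), ContinuousOn e (Set.Icc 0 1) → (∀ t ∈ Set.Icc (0 : ℝ) 1, e t ∈ Z.points) → (∀ t ∈ Set.Icc (0 : ℝ) 1, e t ∈ G) → (∀ i, IsAlgebraic ℚ (e 0 i)) → (∀ i, IsAlgebraic ℚ (e 1 i)) → ∃ γ : CurvePath Z, IsSemialgebraicMapOn ℚ {z : Fin 1 → ℝ | z 0 ∈ Set.Icc (0 : ℝ) 1} (fun z => Fin.append (fun i => (γ.toFun (z 0) i).re) (fun i => (γ.toFun (z 0) i).im)) ∧ γ.toFun 0 = e 0 ∧ γ.toFun 1 = e 1 ∧ ∀ t ∈ Set.Icc (0 : ℝ) 1, γ.toFun t ∈ G) → ∀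 (H : ℝ × ℝ → (Fin Z.n → ℂ)), Continuous H → (∀ x, H x ∈ Z.points) → ∀ (N : ℕ), 0 < N → ∀ (Rx : ℕ → ℕ → Set (Fin Z.n → ℂ)), (∀ p q, IsOpen (Rx p q)) → (∀ p q x, x ∈ gridCell N p q → x ∈ Set.Icc (0 : ℝ) 1 ×ˢ Set.Icc (0 : ℝ) 1 → H x ∈ Rx p q) → (∀ p q, p ≤ N → q ≤ N → (p = 0 ∨ N ≤ p ∨ q = 0 ∨ N ≤ q) → ∀ i, IsAlgebraic ℚ (H ((p : ℝ) / N, (q : ℝ) / N) i)) → ∃ (A : ℕ → ℕ → (Fin Z.n → ℂ)) (eH eV : ℕ → ℕ → CurvePath Z), (∀ p q, (p = 0 ∨ N ≤ p ∨ q = 0 ∨ N ≤ q) → A p q = H ((p : ℝ) / N, (q : ℝ) / N)) ∧ (∀ p q, p < N ∧ 0 < q ∧ q < N → IsSemialgebraicMapOn ℚ {z : Fin 1 → ℝ | z 0 ∈ Set.Icc (0 : ℝ) 1} (fun z => Fin.append (fun i => ((eH p q).toFun (z 0) i).re) (fun i => ((eH p q).toFun (z 0) i).im)) ∧ (eH p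 q).toFun 0 = A p q ∧ (eH p q).toFun 1 = A (p + 1) q ∧ ∀ t ∈ Set.Icc (0 : ℝ) 1, (eH p q).toFun t ∈ Rx p (q - 1) ∩ Rx p q) ∧ (∀ p q, 0 < p ∧ p < N ∧ q < N → IsSemialgebraicMapOn ℚ {z : Fin 1 → ℝ | z 0 ∈ Set.Icc (0 : ℝ) 1} (fun z => Fin.append (fun i => ((eV p q).toFun (z 0) i).re) (fun i => ((eV p q).toFun (z 0) i).im)) ∧ (eV p q).toFun 0 = A p q ∧ (eV p q).toFun 1 = A p (q + 1) ∧ ∀ t ∈ Set.Icc (0 : ℝ) 1, (eV p q).toFun t ∈ Rx (p - 1) q ∩ Rx p q) :=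
  fun _ hZ hPath _ hHc hHZ' _ hN Rx hRxo hRxc hvalg =>
    HomotopyInvariance.exists_grid_edges hZ hPath hHc hHZ' hN Rx hRxo hRxc hvalg

end Summit.KontsevichZagierPeriods.SymplecticScissors.RealOnePeriodRelations

end
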